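import Summits.BirchSwinnertonDyer.BirchSwinnertonDyer.Theses.GenusKolyvaginAtTwo
import Summits.BirchSwinnertonDyer.BirchSwinnertonDyer.Theorems.GenusKolyvaginAtTwoPowDvdShaCardAtTwoRTPowDvdShaCardOfGrossWitnessOrthL
import Summits.BirchSwinnertonDyer.BirchSwinnertonDyer.Theorems.GenusKolyvaginAtTwoPowDvdShaCardAtTwoRTStubCtOrthogonalAtTwo
import HarnessLib

/-!
# v6-LEAD (2026-08-29T20:1xZ, LEAD gk2-p1 g18 = gk2-p2 g20's `plus_descent_e4_v6_gk2p2.lean` with X-ORTH∃ CLOSED BY NAME): registered stubs = {P `stub_pubInputsAtTwo`} —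
# L_T `PowDvdShaCardAtTwoRT` (stmt-BirchSwinnertonDyer-23659) BY NAME MODULO PRINT (P = the route's displayed published inputs; road (E4) uses only its
# Kolyvagin conjunct — gk2-p4 g21 is cutting the closer to it) and the crux's own antecedent Q2.  Supersedes v5.7 (genus architecture; stubs {Deep, P}).
# BSD is NOT proved by any of this; L_T is NOT proved unconditionally (P open); nothing is closed.
-/

/-!
# LINE 18 `plus_descent` — SKELETON v6 «E4» on route rev 37 (LEAD ruling R5; (β″) executed 19:19Z): the crux L_T `PowDvdShaCardAtTwoRT`
# (stmt-BirchSwinnertonDyer-23659, ex 23299 / 23242) BY NAME from TWO stubs — X-ORTH∃ (Cassels–Tate orthogonality of the (+)/(−) Kolyvagin classes, packaged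
# with the choice of the level pairing; gk2-p5 g27's `…RTStubCtOrthogonalAtTwo` p740728 proves this text VERBATIM) and P (the route's displayed published
# inputs; only the Kolyvagin conjunct is used) — through road (E4)'s closer `pow_dvd_natCard_sha_of_grossWitness_of_orthogonal_onHabitatL` (gk2-p2 g20, p739879).
# No twin `Wd`, no genus budget, no Shallow/Deep/3a⁗/3b″/GP/K; NPh and KS are THEOREMS inside the closer (gk2-p3 p714902; gk2-p3 p735895 ∘ LEAD p734487 ∘ gk2-p5
# p727553/p728398 ∘ gk2-p2 p727242/p738000; capstone p737508/p737814/p738269/p739879; X-ORTH pieces gk2-p4 p735742/p736279/p737238/p737472/p737900/p738908/p739464,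
# gk2-p5 p738662/p739559/p740274).

Sorries ONLY in the two `stub_*`.  BSD is NOT proved; L_T is NOT proved (P is a conjunction of named published inputs — the line's explicit conditional).

* `stub_pubInputsAtTwo : PubInputsAtTwo` — as in v5.x (GZ all levels ∧ Kolyvagin ∧ GZK-published inputs ∧ modularity ∧ Milne); road (E4) uses ONLY the Kolyvagin
  conjunct (`rank E(K) = 1`, for the sign of the Mordell–Weil line); gk2-p4 g21 is cutting P to that conjunct.
* `stub_ctOrthogonalAtTwo` — X-ORTH∃ (text FROZEN 19:16Z, identical to the draft `Lines/plus_descent_e4_draft…` l.65–95 and to gk2-p5's p740728): on L_T's frame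
  (binders through `hndiv`; the witness binders are not part of it, so (β″) did not change this text), for the non-trivial `τ` and every pairing exponent
  `k ≥ M₀ + 6` (level `L = 2k`, margin `1`), SOME bi-additive `B` on `Ш(E_K)[2^k]` into `ℚ/ℤ` with the level-kernel clause kills «(+)-provenance × (−)-provenance».
* `PowDvdShaCardAtTwoRT_of_stubs` — the composition (kernel-checked): `τ` from `exists_gal_ne_one_sqrt_discr`, `k := M₀ + 6`, Gross witness := the crux's `(n, d)`.

References: [McCallumLMS1991] §4 Prop. 4.7, §5 Prop. 5.2, Thm. 5.4; [Kolyvagin1991StructureSha]; [GrossLMS1991] §3 (3.1)–(3.3), §5 Prop. 5.3–5.4;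
[LawsonWuthrich2016] §7.1; [MilneADT2006] Ch. I §6 Lemma 6.17.
-/

set_option linter.dupNamespace false
set_option autoImplicit false

noncomputable section

namespace Summit.BirchSwinnertonDyer.BirchSwinnertonDyer.Cruxes.PowDvdShaCardAtTwoRT.PlusDescentE4

open scoped Classical
open scoped AddSubgroup
open WeierstrassCurve NumberField IsDedekindDomain Field
open Literature.NumberTheory.GaloisRepresentations Literature.NumberTheory.EllipticCurves
open Literature.NumberTheory
open Summit.BirchSwinnertonDyer.BirchSwinnertonDyer.Theses.GenusKolyvaginAtTwo
open Summit.BirchSwinnertonDyer.BirchSwinnertonDyer.Theorems.GenusExact.PlusDescent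

/-- stub P (BY NAME — the route's displayed published inputs + Kolyvagin's theorem; the line's explicit conditional, as in v5.3).
[cite: GrossZagier1986] [cite: Kolyvagin1989] [cite: BCDTJAMS2001] [cite: Milne1972ArithmeticAV, §1 Thm 1] -/
theorem stub_pubInputsAtTwo : PubInputsAtTwo := by
  sorry

/-- stub X-ORTH∃ `stub_ctOrthogonalAtTwo` (M, PLUMBING over landed files — gk2-p4 g20's socket, memo `Lines/plus-descent-deep-orthogonality-gk2p4.md` §4,
packaged with the CHOICE of the level pairing): on L_T's frame, for the non-trivial `τ` and every `k ≥ M₀ + 6` (`L = 2k`, margin `1`), some bi-additive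
`B : Ш(E_K)[2^k] × Ш(E_K)[2^k] → ℚ/ℤ` with the Cassels–Tate level clause «`B(x,·) = 0 ⟹ x ∈ 2^k Ш`» VANISHES on (image of a (+)-provenance class) ×
(image of a (−)-provenance class), where a provenance class is `2^{2k−e} c_{2k}(n)` (`e ≤ k`) for a Kolyvagin datum at a square-free `n` whose primes are
Zhang–Kolyvagin of index `≥ 2k` with `FrobEqFrobInfty W K (2^(2k))`, GIVEN to be Selmer, to vanish at its own primes, and to have sign `±w(E)`.
Intended: `B := ctLevelPairing … canonical`; vanishing = McCallum Prop. 4.7 as a sum of local terms, each zero (Kummer × Kummer off `nn′`; own primes of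
the (−)-class; CROSS places by the regular-module cross-sign lemma p736279, which needs exactly `FrobEqFrobInfty W K (2^(2k))`).  Why it might fail: only dialect/plumbing risk (R1–R6 of the memo are non-arithmetic); the arithmetic core is landed.
[cite: McCallumLMS1991, §4 Prop. 4.7, §5 Lemma 5.3] [cite: MilneADT2006, Ch. I §6 Lemma 6.17] [cite: Kolyvagin1991StructureSha] -/
theorem stub_ctOrthogonalAtTwo :
    PubInputsAtTwo → KolyvaginRelationAtTwo → EquivariantChebotarevAtTwoR → ∀ (W : WeierstrassCurve ℚ) [W.IsElliptic] [W.IsGloballyMinimal] [NeZero (W.conductorNorm ℤ)], ¬ W.HasCM → Odd W.tamagawaProduct → ∀ (v : IsDedekindDomain.HeightOneSpectrum (NumberField.RingOfIntegers ℚ)), ((2 : ℕ) : NumberField.RingOfIntegers ℚ) ∉ v.asIdeal → ((W.conductorNorm ℤ : ℕ) : NumberField.RingOfIntegers ℚ) ∈ v.asIdeal → W.HasMultiplicativeReductionAt v → W.Δ < 0 → ∀ (K : Type) [Field K] [NumberField K], Literature.NumberTheory.EllipticCurves.IsImaginaryQuadratic K → Odd (NumberField.discr K) → NumberField.discr K ≠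 -3 → Literature.NumberTheory.EllipticCurves.SatisfiesHeegnerHypothesis (W.conductorNorm ℤ) K → ¬ IsSquare ((NumberField.discr K : ℚ) * -|W.Δ|) → ¬ IsSquare ((NumberField.discr K : ℚ) * (-(2 * |W.Δ|))) → (∀ n : ℕ, 0 < n → W.HasSurjectiveModNGaloisRep ((2 : ℤ) ^ n)) → ∀ (Dt : Literature.NumberTheory.EllipticCurves.ModularForms.ModularParametrizationData W (W.conductorNorm ℤ)) (β : ℤ) (ι : K →+* ℂ) (d₁ : Literature.NumberTheory.EllipticCurves.KolyvaginHeegnerData Dt β ι 1), ¬ IsOfFinAddOrder d₁.derivedPoint → ∀ (M₀ : ℕ), (∃ Q : (W.baseChange (Literature.NumberTheory.EllipticCurves.ringClassField K ι 1)).toAffine.Point, ((2 ^ M₀ : ℕ) : ℤ) • Q = d₁.derivedPoint) → (¬ ∃ Q : (W.baseChange (Literature.NumberTheory.EllipticCurves.ringClassField K ι 1)).toAffine.Point, ((2 ^ (M₀ + 1) : ℕ) : ℤ) • Q = d₁.derivedPoint) → ∀ τ : K ≃ₐ[ℚ] K, τ ≠ 1 → ∀ k : ℕ, M₀ + 6 ≤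 k →
      ∃ B : ↥((↥(W.baseChange K).sha)[((2 ^ k : ℕ) : ℤ)]) →+ ↥((↥(W.baseChange K).sha)[((2 ^ k : ℕ) : ℤ)]) →+ AddCircle (1 : ℚ),
      (∀ x : ↥((↥(W.baseChange K).sha)[((2 ^ k : ℕ) : ℤ)]), B x = 0 →
        ∃ z : (W.baseChange K).sha, (2 ^ k) • z = (x : (W.baseChange K).sha)) ∧
      (∀ x x' : ↥((↥(W.baseChange K).sha)[((2 ^ k : ℕ) : ℤ)]),
      (∃ (n : ℕ) (d : KolyvaginHeegnerData Dt β ι n) (e : ℕ), Squarefree n ∧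
        (∀ ℓ ∈ n.primeFactors, Zhang2014.IsKolyvaginPrime (W.conductorNorm ℤ) W K 2 ℓ ∧ 2 * k ≤ Zhang2014.kolyvaginIndex W 2 ℓ ∧
          FrobEqFrobInfty W K (2 ^ (2 * k)) ℓ) ∧
        e ≤ k ∧
        ((2 ^ (2 * k - e) : ℕ) : ℤ) • d.kolyvaginClass Nat.prime_two (2 * k) ∈ selmerGroup (W.baseChange K) ((2 ^ (2 * k) : ℕ) : ℤ) ∧
        (∀ ℓ ∈ n.primeFactors, ∀ u : HeightOneSpectrum (𝓞 K), ((ℓ : ℕ) : 𝓞 K) ∈ u.asIdeal →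
          ((2 ^ (2 * k - e) : ℕ) : ℤ) • d.kolyvaginClass Nat.prime_two (2 * k) ∈
            (W.baseChange K).torsionLocalKer (u.adicCompletion K) ((2 ^ (2 * k) : ℕ) : ℤ)) ∧
        conjAct W τ ((2 ^ (2 * k) : ℕ) : ℤ) (((2 ^ (2 * k - e) : ℕ) : ℤ) • d.kolyvaginClass Nat.prime_two (2 * k)) =
          W.rootNumber • (((2 ^ (2 * k - e) : ℕ) : ℤ) • d.kolyvaginClass Nat.prime_two (2 * k)) ∧
        ((x : (W.baseChange K).sha) : (W.baseChange K).galH1) =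
          torsionH1ToH1 (W.baseChange K) ((2 ^ (2 * k) : ℕ) : ℤ) (((2 ^ (2 * k - e) : ℕ) : ℤ) • d.kolyvaginClass Nat.prime_two (2 * k))) →
      (∃ (n : ℕ) (d : KolyvaginHeegnerData Dt β ι n) (e : ℕ), Squarefree n ∧
        (∀ ℓ ∈ n.primeFactors, Zhang2014.IsKolyvaginPrime (W.conductorNorm ℤ) W K 2 ℓ ∧ 2 * k ≤ Zhang2014.kolyvaginIndex W 2 ℓ ∧
          FrobEqFrobInfty W K (2 ^ (2 * k)) ℓ) ∧
        e ≤ k ∧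
        ((2 ^ (2 * k - e) : ℕ) : ℤ) • d.kolyvaginClass Nat.prime_two (2 * k) ∈ selmerGroup (W.baseChange K) ((2 ^ (2 * k) : ℕ) : ℤ) ∧
        (∀ ℓ ∈ n.primeFactors, ∀ u : HeightOneSpectrum (𝓞 K), ((ℓ : ℕ) : 𝓞 K) ∈ u.asIdeal →
          ((2 ^ (2 * k - e) : ℕ) : ℤ) • d.kolyvaginClass Nat.prime_two (2 * k) ∈
            (W.baseChange K).torsionLocalKer (u.adicCompletion K) ((2 ^ (2 * k) : ℕ) : ℤ)) ∧
        conjAct W τ ((2 ^ (2 * k) : ℕ) : ℤ) (((2 ^ (2 * k - e) : ℕ) : ℤ) • d.kolyvaginClass Nat.prime_two (2 * k)) =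
          (-W.rootNumber) • (((2 ^ (2 * k - e) : ℕ) : ℤ) • d.kolyvaginClass Nat.prime_two (2 * k)) ∧
        ((x' : (W.baseChange K).sha) : (W.baseChange K).galH1) =
          torsionH1ToH1 (W.baseChange K) ((2 ^ (2 * k) : ℕ) : ℤ) (((2 ^ (2 * k - e) : ℕ) : ℤ) • d.kolyvaginClass Nat.prime_two (2 * k))) →
      B x x' = 0) :=
  -- v6 (LEAD gk2-p1 g18): X-ORTH∃ is a THEOREM BY NAME — gk2-p5 g27 `…RTStubCtOrthogonalAtTwo` (p740728; over gk2-p4 g20's one-pair theorem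
  -- `ctLevelPairing_eq_zero_of_opposite_signs` p738908 + pairing side + hnofix, and gk2-p5's provenance adapter `…RTCrossPairProvenanceSocket`).
  Summit.BirchSwinnertonDyer.BirchSwinnertonDyer.Theorems.GenusExact.PlusDescent.stub_ctOrthogonalAtTwo

/-- **Composition v6 «E4» on route rev 37 (after (β″); sorries only in the TWO stubs X-ORTH∃ and P)**: L_T `PowDvdShaCardAtTwoRT`
(stmt-BirchSwinnertonDyer-23659) BY NAME through road (E4)'s closer `pow_dvd_natCard_sha_of_grossWitness_of_orthogonal_onHabitatL` (p739879); the crux's own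
witness `(n, d, hn, hKoly, hPn)` — now in Gross currency — IS the closer's Gross witness (W-UP′ is gone); `k := M₀ + 6`, `L := 2k`, margin `1`; NPh and KS are
theorems inside the closer. [cite: McCallumLMS1991, §5 Thm. 5.4]
[cite: Kolyvagin1991StructureSha] -/
theorem PowDvdShaCardAtTwoRT_of_stubs : PowDvdShaCardAtTwoRT := by
  intro hQ2 hQ5R _hQ1 W _ _ _ hcm hT v h2v hNv hmult hneg K _ _ hIQ hodd h3 hHe hsq1 hsq2 hρ Dt β ι d₁ hy M₀ hdiv hndiv n d hn hKoly hPn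
  obtain ⟨τ, -, hτ, -, -, -, -⟩ := exists_gal_ne_one_sqrt_discr (K := K) hIQ.1
  obtain ⟨B, hker, hOrth⟩ := stub_ctOrthogonalAtTwo stub_pubInputsAtTwo hQ2 hQ5R W hcm hT v h2v hNv hmult hneg K hIQ hodd h3 hHe hsq1 hsq2 hρ
    Dt β ι d₁ hy M₀ hdiv hndiv τ hτ (M₀ + 6) le_rfl
  exact pow_dvd_natCard_sha_of_grossWitness_of_orthogonal_onHabitatL stub_pubInputsAtTwo hQ2 W hcm hT hneg K hIQ hodd h3 hHe hsq1 hsq2 h2v hNv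
    hmult hρ Dt β ι d₁ hy M₀ hdiv hndiv τ hτ (2 * (M₀ + 6)) 1 (M₀ + 6) (by omega) le_rfl (by omega) hn hKoly d hPn B hker hOrth

end Summit.BirchSwinnertonDyer.BirchSwinnertonDyer.Cruxes.PowDvdShaCardAtTwoRT.PlusDescentE4

end
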